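import Mathlib
import Summits.QuantumFields.QCD.Theorems.QuarksAsStableActionUnquenchedChessboardBoundLinkGramSort
import HarnessLib

/-!
# Link Gram identity, part 6: the bonds of a symmetric slab (crux stmt-QuantumFields-9735, line
`Sketch`, lead's stub `linkGram`)

Finset bookkeeping for the closed slab `F = slabBonds (-p) (2p+1)` of the slices `-p, …, p + 1`
(`4 ≤ L`, `2p + 1 ≤ L/2`) and its upper half `A = slabBonds 1 p` (slices `1, …, p + 1`), relative to
the upper sites `linkUpSites p` of the link reflection `t ↦ 1 - t`:
* `slab_bonds_mem_up_or_lo` — every bond of `F` joins upper/lower sites (hypothesis of the block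
  decomposition);
* `slab_lowerCross_mem` — `F` contains the lower crossing layer `t = 0 → 1`;
* `image_edgeReflect_slab` — `F` is reflection symmetric;
* `upper_slab_bonds_mem_up` — every bond of `A` joins upper sites;
* `mem_slab_iff_mem_upper_of_up` — between upper sites, `F` and `A` have the same bonds.
All statements are proved.
-/

noncomputable section

open Finset
open Literature.MathematicalPhysics.QuantumFieldTheory Literature.MathematicalPhysics.QuantumLattice
open Literature.Probability.LatticeModels (TorusSite)
open Summit.QuantumFields.QCD.Theorems.QuarksAsStableAction

namespace Summit.QuantumFields.QCD.Theorems.UnquenchedChessboardBoundLine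

variable {L : ℕ} [NeZero L] [Fact (1 < L)]

/-! ## Time arithmetic -/

omit [Fact (1 < L)] in
/-- `val (t + p)` for `p < L`. -/
theorem val_add_nat (t : ZMod L) {p : ℕ} (hp : p < L) :
    (t + (p : ZMod L)).val = if t.val + p < L then t.val + p else t.val + p - L := by
  rw [ZMod.val_add, ZMod.val_natCast, Nat.mod_eq_of_lt hp]
  have ht := ZMod.val_lt t
  split_ifs with h
  · exact Nat.mod_eq_of_lt h
  · rw [Nat.mod_eq_sub_mod (by omega), Nat.mod_eq_of_lt (by omega)]

/-- `val (t - 1)`. -/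
theorem val_sub_one' (t : ZMod L) :
    (t - 1).val = if t.val = 0 then L - 1 else t.val - 1 := by
  have h1 : 1 < L := Fact.out
  have ht := ZMod.val_lt t
  split_ifs with h
  · rw [(ZMod.val_eq_zero t).1 h, zero_sub, ZMod.neg_val, if_neg (by
      intro h0
      have := congrArg ZMod.val h0
      rw [ZMod.val_one, ZMod.val_zero] at this
      omega), ZMod.val_one]
  · have : t - 1 = ((t.val - 1 : ℕ) : ZMod L) := by
      rw [Nat.cast_sub (by omega), ZMod.natCast_zmod_val, Nat.cast_one]
    rw [this, ZMod.val_natCast, Nat.mod_eq_of_lt (by omega)]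

/-- Membership of a site in the lower half: `θx` is upper iff `t = 0` or `t ≥ L - p`
(`2 ≤ L - p`). -/
theorem timeReflect_mem_linkUpSites_iff {p : ℕ} (hpL : p + 2 ≤ L) (x : TorusSite 4 L) :
    Site.timeReflect x ∈ linkUpSites p ↔ (x 0).val = 0 ∨ L - p ≤ (x 0).val := by
  rw [mem_linkUpSites, WilsonRP.val_timeReflect]
  have hx := ZMod.val_lt (x 0)
  split_ifs with h0 h1 <;> omega

/-! ## The bonds of the symmetric slab -/

omit [Fact (1 < L)] in
/-- Membership in the symmetric slab `F = slabBonds (-p) (2p+1)` by the time of the base point: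
spatial bonds for `t ∈ [0, p+1] ∪ [L-p, L)`, temporal bonds for `t ∈ [0, p] ∪ [L-p, L)`. -/
theorem mem_symmSlab_iff {p : ℕ} (hpL : 2 * p + 2 < L) (b : Edge 4 L) :
    b ∈ slabBonds (-(p : ZMod L)) (2 * p + 1) ↔
      ((b.1 0).val ≤ p + 1 ∨ L - p ≤ (b.1 0).val) ∧
        (b.2 ≠ 0 ∨ ((b.1 0).val ≤ p ∨ L - p ≤ (b.1 0).val)) := by
  rw [mem_slabBonds, sub_neg_eq_add, val_add_nat _ (by omega)]
  have hx := ZMod.val_lt (b.1 0)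
  by_cases hμ : b.2 = 0
  · simp only [hμ, ne_eq, not_true_eq_false, false_or]
    split_ifs with h <;> omega
  · simp only [ne_eq, hμ, not_false_eq_true, true_or, and_true]
    split_ifs with h <;> omega

/-- Membership in the upper slab `A = slabBonds 1 p`: spatial bonds for `t ∈ [1, p+1]`, temporal
bonds for `t ∈ [1, p]`. -/
theorem mem_upperSlab_iff {p : ℕ} (hpL : 2 * p + 2 < L) (b : Edge 4 L) :
    b ∈ slabBonds (1 : ZMod L) p ↔
      (1 ≤ (b.1 0).val ∧ (b.1 0).val ≤ p + 1) ∧ (b.2 ≠ 0 ∨ (b.1 0).val ≤ p) := by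
  rw [mem_slabBonds, val_sub_one']
  have hx := ZMod.val_lt (b.1 0)
  by_cases hμ : b.2 = 0
  · simp only [hμ, ne_eq, not_true_eq_false, false_or]
    split_ifs with h <;> omega
  · simp only [ne_eq, hμ, not_false_eq_true, true_or, and_true]
    split_ifs with h <;> omega

/-- Time of the far endpoint of a bond. -/
theorem val_shift_endpoint (b : Edge 4 L) :
    ((b.1.shift b.2) 0).val =
      if b.2 = 0 then (if (b.1 0).val + 1 = L then 0 else (b.1 0).val + 1) else (b.1 0).val := by
  by_cases hμ : b.2 = 0
  · rw [if_pos hμ, hμ, WilsonRP.val_shift_self]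
  · rw [if_neg hμ, WilsonRP.val_shift_of_ne _ (Ne.symm hμ)]

/-- **Every bond of the symmetric slab joins upper or lower sites.** -/
theorem slab_bonds_mem_up_or_lo {p : ℕ} (hpL : 2 * p + 2 < L) :
    ∀ b ∈ slabBonds (-(p : ZMod L)) (2 * p + 1),
      (b.1 ∈ linkUpSites p ∨ Site.timeReflect b.1 ∈ linkUpSites p) ∧
        (b.1.shift b.2 ∈ linkUpSites p ∨ Site.timeReflect (b.1.shift b.2) ∈ linkUpSites p) := by
  intro b hb
  rw [mem_symmSlab_iff hpL] at hb
  rw [timeReflect_mem_linkUpSites_iff (by omega), timeReflect_mem_linkUpSites_iff (by omega),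
    mem_linkUpSites, mem_linkUpSites, val_shift_endpoint]
  have hx := ZMod.val_lt (b.1 0)
  by_cases hμ : b.2 = 0
  · simp only [hμ, ne_eq, not_true_eq_false, false_or, ↓reduceIte] at hb ⊢
    constructor
    · omega
    · split_ifs with h <;> omega
  · simp only [ne_eq, hμ, not_false_eq_true, true_or, and_true, ↓reduceIte] at hb ⊢
    constructor <;> omega

omit [Fact (1 < L)] in
/-- **The symmetric slab contains the lower crossing layer** `t = 0 → 1`. -/
theorem slab_lowerCross_mem {p : ℕ} (hpL : 2 * p + 2 < L) (x : TorusSite 4 L) (hx : (x 0).val = 0) :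
    ((x, (0 : Fin 4)) : Edge 4 L) ∈ slabBonds (-(p : ZMod L)) (2 * p + 1) := by
  rw [mem_symmSlab_iff hpL]
  simp only [hx]
  omega

/-- Reflection maps slab bonds to slab bonds. -/
theorem edgeReflect_mem_slab {p : ℕ} (hpL : 2 * p + 2 < L) {b : Edge 4 L}
    (hb : b ∈ slabBonds (-(p : ZMod L)) (2 * p + 1)) :
    WilsonRP.edgeReflect b ∈ slabBonds (-(p : ZMod L)) (2 * p + 1) := by
  rw [mem_symmSlab_iff hpL] at hb ⊢
  have hx := ZMod.val_lt (b.1 0)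
  unfold WilsonRP.edgeReflect
  by_cases hμ : b.2 = 0
  · simp only [hμ, ↓reduceIte, ne_eq, not_true_eq_false, false_or] at hb ⊢
    rw [WilsonRP.val_timeReflect_shift_zero]
    split_ifs with h <;> omega
  · simp only [hμ, ↓reduceIte, ne_eq, not_false_eq_true, true_or, and_true] at hb ⊢
    rw [WilsonRP.val_timeReflect]
    split_ifs with h0 h1 <;> omega

/-- **The symmetric slab is reflection symmetric.** -/
theorem image_edgeReflect_slab {p : ℕ} (hpL : 2 * p + 2 < L) :
    (slabBonds (-(p : ZMod L)) (2 * p + 1)).image WilsonRP.edgeReflect =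
      slabBonds (-(p : ZMod L)) (2 * p + 1) := by
  ext b
  rw [Finset.mem_image]
  constructor
  · rintro ⟨c, hc, rfl⟩
    exact edgeReflect_mem_slab hpL hc
  · intro hb
    exact ⟨WilsonRP.edgeReflect b, edgeReflect_mem_slab hpL hb, WilsonRP.edgeReflect_edgeReflect b⟩

/-- **Every bond of the upper slab joins upper sites.** -/
theorem upper_slab_bonds_mem_up {p : ℕ} (hpL : 2 * p + 2 < L) :
    ∀ b ∈ slabBonds (1 : ZMod L) p, b.1 ∈ linkUpSites p ∧ b.1.shift b.2 ∈ linkUpSites p := by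
  intro b hb
  rw [mem_upperSlab_iff hpL] at hb
  rw [mem_linkUpSites, mem_linkUpSites, val_shift_endpoint]
  by_cases hμ : b.2 = 0
  · simp only [hμ, ne_eq, not_true_eq_false, false_or, ↓reduceIte] at hb ⊢
    constructor
    · omega
    · split_ifs with h <;> omega
  · simp only [ne_eq, hμ, not_false_eq_true, true_or, and_true, ↓reduceIte] at hb ⊢
    omega

/-- **Between upper sites the symmetric slab and its upper half have the same bonds.** -/
theorem mem_slab_iff_mem_upper_of_up {p : ℕ} (hpL : 2 * p + 2 < L) (b : Edge 4 L)
    (h1 : b.1 ∈ linkUpSites p) (h2 : b.1.shift b.2 ∈ linkUpSites p) :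
    b ∈ slabBonds (-(p : ZMod L)) (2 * p + 1) ↔ b ∈ slabBonds (1 : ZMod L) p := by
  rw [mem_symmSlab_iff hpL, mem_upperSlab_iff hpL]
  rw [mem_linkUpSites] at h1 h2
  rw [val_shift_endpoint] at h2
  have hx := ZMod.val_lt (b.1 0)
  by_cases hμ : b.2 = 0
  · simp only [hμ, ne_eq, not_true_eq_false, false_or, ↓reduceIte] at h2 ⊢
    split_ifs at h2 with h <;> omega
  · simp only [ne_eq, hμ, not_false_eq_true, true_or, and_true, ↓reduceIte] at h2 ⊢
    omega

end Summit.QuantumFields.QCD.Theorems.UnquenchedChessboardBoundLine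

end
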